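import Summits.QuantumFields.GaugeBoot.StrongCouplingOrderSuN
import HarnessLib

/-!
# `U(N)` (and `U(1)`) on the torus: β = 0 exactness and the `O(β^q)` sandwich of the word-truncated bootstrap (gauge-boot, L1 supplement)

HONEST FRAMING (cell `pub-gaugeboot`, page 1 of every file): the venture produces certified bounds
on lattice expectations at stated coupling, gauge group, dimension and torus size; NOT a mass gap,
NOT a continuum limit, NOT a string tension; NOT Yang–Mills-summit-bearing (barriers
`FixedCouplingUltralocality`, `PerturbativeInvisibility`). Structural, qualitatively quantitative:
constants are not computed; no number is certified.

## Content

The `U(N)` twins of the `SU(N)` statements of `StrongCouplingOrderSuN.lean` (which proved the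
width bound `levelValues_width_le_pow_uN` only). `N = 1` is compact `U(1)` lattice gauge theory — the
abelian bootstrap of Li–Zhou (arXiv:2404.17071) — so these are also statements about that system.

* ★★★ `levelValues_zero_eq_singleton_uN` — at `β = 0` the level-`M` `U(N)` bootstrap is EXACT on
  every test function of length `≤ M` (the single Haar value); `apply_eq_haar_of_rows_zero_uN` —
  indeed the rows alone (no positivity) give `φ P = φ 1 · ∫ P dHaar`;
* ★★★ `levelValues_subset_Icc_pow_uN`, `levelValues_width_le_pow_level_uN` — for `P` of length
  `≤ n` and level `M ≥ max n 4`: `levelValuesUN N β M P ⊆ [W_β(P) - C|β|^q, W_β(P) + C|β|^q]`,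
  `q = (M - n)/4 + 1`, for every real `β`.

References: Z. Li, S. Zhou, arXiv:2404.17071 (U(1)); V. Kazakov, Z. Zheng, arXiv:2203.11360;
Yu. Makeenko (2002) Problem 12.7. Folklore mechanism; truncated statement new.
-/

noncomputable section

open MeasureTheory Filter Topology NormedSpace
open Literature.MathematicalPhysics.QuantumFieldTheory (LatticeRep haarProbability Edge GaugeConfig
  wilsonAction wilsonMeasure isProbabilityMeasure_wilsonMeasure)
open Literature.MathematicalPhysics.QuantumLattice

namespace Summit.QuantumFields.GaugeBoot

section UN

variable {d L : ℕ} [NeZero L] (N : ℕ)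

/-- ★★★ **`U(N)`, `β = 0`: the level-`n` loop equations ALONE — no positivity — determine every test
function of length `≤ n`**: `φ P = φ 1 · ∫ P dHaar`. [folklore] -/
theorem apply_eq_haar_of_rows_zero_uN {n : ℕ}
    {P : C(GaugeConfig d L (Matrix.unitaryGroup (Fin N) ℂ), ℝ)}
    (hP : P ∈ wordTruncation (ι := Edge d L) (unitaryFundamentalLatticeRep N) n)
    (φ : C(GaugeConfig d L (Matrix.unitaryGroup (Fin N) ℂ), ℝ) →ₗ[ℝ] ℝ)
    (hφ : ∀ (i : Edge d L) (a : UGenerator N),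
      ∀ f ∈ wordTruncation (ι := Edge d L) (unitaryFundamentalLatticeRep N) n, φ (sderiv (uExp N) i a f) = 0) :
    φ P = φ 1 * ∫ U, P U ∂(wilsonMeasure (unitaryFundamentalRep (Fin N) ℂ) 0) := by
  haveI : IsProbabilityMeasure (wilsonMeasure (d := d) (L := L) (unitaryFundamentalRep (Fin N) ℂ) 0) :=
    isProbabilityMeasure_wilsonMeasure (ρ := unitaryFundamentalRep (Fin N) ℂ)
      (continuous_unitaryFundamentalRep (n := Fin N) (𝕜 := ℂ)) 0
  have hP' : P ∈ wordSpace (unitaryFundamentalLatticeRep N)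
      ((Finset.univ : Finset (Edge d L)) : Set (Edge d L)) n := by
    rw [Finset.coe_univ]; exact mem_wordSpace_univ_of_mem_wordTruncation _ hP
  have hfeas := isBootstrapFeasible_wilson_uN (d := d) (L := L) N 0 _ rfl subset_rfl
  have h := apply_eq_of_rows_zero (r := unitaryFundamentalLatticeRep N) (uExp_add N)
    (X := fun X : UGenerator N => (X : Matrix (Fin N) (Fin N) ℂ)) (rho_uExp N)
    (fun g => exists_uExp_eq N g) (uGen N) (uGen_span N)
    (φ₀ := expectationFunctional (wilsonMeasure (unitaryFundamentalRep (Fin N) ℂ) 0))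
    (rows_zero_of_feasible (unitaryFundamentalLatticeRep N) (uExp_add N) (rho_uExp N) hfeas)
    (fun f _ => expectationFunctional_sq_nonneg _ f)
    (fun f _ hf => eq_zero_of_integral_mul_self_eq_zero (unitaryFundamentalRep (Fin N) ℂ) f hf)
    Finset.univ n hφ hP'
  rw [h, expectationFunctional_one, div_one, expectationFunctional_apply, mul_comm]

/-- ★★★ **At `β = 0` the level-`M` `U(N)` bootstrap is EXACT on every test function of length
`≤ M`**: its feasible set is the single Haar value. [folklore] -/
theorem levelValues_zero_eq_singleton_uN {n M : ℕ} (hnM : n ≤ M)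
    {P : C(GaugeConfig d L (Matrix.unitaryGroup (Fin N) ℂ), ℝ)}
    (hP : P ∈ wordTruncation (ι := Edge d L) (unitaryFundamentalLatticeRep N) n) :
    levelValuesUN (d := d) (L := L) N 0 M P =
      {∫ U, P U ∂(wilsonMeasure (unitaryFundamentalRep (Fin N) ℂ) 0)} := by
  refine Set.eq_singleton_iff_unique_mem.2 ⟨wilson_mem_levelValues_uN N 0 M P, fun t ht => ?_⟩
  obtain ⟨φ, hφ, rfl⟩ := ht
  have hrows : ∀ (i : Edge d L) (a : UGenerator N),
      ∀ f ∈ wordTruncation (ι := Edge d L) (unitaryFundamentalLatticeRep N) M,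
        φ (sderiv (uExp N) i a f) = 0 := fun i a f hf => by
    rw [hφ.rows_sderiv (uExp_add N) (rho_uExp N)
      (hasDerivAt_torusActionDeriv (unitaryFundamentalLatticeRep N) (uExp_add N) (rho_uExp N))
      (wordTruncation_subset_polyAlgebra _ M) i a hf, zero_mul]
  rw [apply_eq_haar_of_rows_zero_uN (d := d) (L := L) N (wordTruncation_mono _ hnM hP) φ hrows, hφ.1,
    one_mul]

/-- ★★★ **The truncated `U(N)` bootstrap bounds are within `O(|β|^q)` of the Wilson value.**
[folklore mechanism; truncated statement new] -/
theorem levelValues_subset_Icc_pow_uN {n : ℕ} {P : C(GaugeConfig d L (Matrix.unitaryGroup (Fin N) ℂ), ℝ)}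
    (hP : P ∈ wordTruncation (ι := Edge d L) (unitaryFundamentalLatticeRep N) n) (q : ℕ) :
    ∃ C : ℝ, 0 ≤ C ∧ ∀ (M : ℕ), n + 4 * q ≤ M + 4 → n + 4 * q ≤ 2 * M → ∀ β : ℝ,
      levelValuesUN (d := d) (L := L) N β M P ⊆
        Set.Icc (∫ U, P U ∂(wilsonMeasure (unitaryFundamentalRep (Fin N) ℂ) β) - C * |β| ^ q)
          (∫ U, P U ∂(wilsonMeasure (unitaryFundamentalRep (Fin N) ℂ) β) + C * |β| ^ q) := by
  obtain ⟨C, hC0, hC⟩ := levelValues_width_le_pow_uN (d := d) (L := L) N hP q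
  refine ⟨C, hC0, fun M hM hM2 β t ht => ?_⟩
  have h := abs_le.1 (hC M hM hM2 β t ht _ (wilson_mem_levelValues_uN N β M P))
  exact ⟨by linarith [h.1], by linarith [h.2]⟩

/-- ★★★ **The exponent as a function of the level** (`U(N)`): for `P` of length `≤ n` and
`M ≥ max n 4`, `width(levelValuesUN M) ≤ C |β|^{(M - n)/4 + 1}`. [folklore mechanism; truncated
statement new] -/
theorem levelValues_width_le_pow_level_uN {n : ℕ} {P : C(GaugeConfig d L (Matrix.unitaryGroup (Fin N) ℂ), ℝ)}
    (hP : P ∈ wordTruncation (ι := Edge d L) (unitaryFundamentalLatticeRep N) n) {M : ℕ} (hnM : n ≤ M)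
    (h4 : 4 ≤ M) :
    ∃ C : ℝ, 0 ≤ C ∧ ∀ β : ℝ, ∀ s ∈ levelValuesUN (d := d) (L := L) N β M P,
      ∀ t ∈ levelValuesUN (d := d) (L := L) N β M P, |s - t| ≤ C * |β| ^ ((M - n) / 4 + 1) := by
  obtain ⟨C, hC0, hC⟩ := levelValues_width_le_pow_uN (d := d) (L := L) N hP ((M - n) / 4 + 1)
  refine ⟨C, hC0, fun β s hs t ht => hC M ?_ ?_ β s hs t ht⟩
  · have := Nat.div_mul_le_self (M - n) 4
    omega
  · have := Nat.div_mul_le_self (M - n) 4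
    omega

end UN

end Summit.QuantumFields.GaugeBoot

end
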